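import Mathlib
import Summits.KontsevichZagierPeriods.Zeta5Search.FamilyCellDAtlas
import Summits.KontsevichZagierPeriods.Zeta5Search.RecordCellDAtlas
import HarnessLib

/-!
# ζ(5) search — the CLASS ATLAS of the record ray at the primes `6n < p < 6.25n` (census g11 cell E; gen-2 g9's "zero" cell `(6, 19/3]`)

Cell `pub-zeta5` (HONEST FRAMING: systematic search; no irrationality claim unless certified), P1 prover seat generation 6.
Census g11's atlas (`STRUCTURE §15.4`) lists the cell **E = (6, 25/4)** of the record ray `b(n) = n·(41;17,…,11)` (weight 0.250; truth
`v_p(Cas₇) = −14`; the tree's THEOREM LB gives `−17`); gen-2 g9 (REPORT §10) explains `(6, 19/3]` as a "zero" cell with `m = −10`: the ONLY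
minimal classes are the centre-free six-point palindromes `(1,0,−6,−6,0,1)`.  This file is the arithmetic for `24n < 4p < 25n`: classes of six
or seven points (`classSet_bRecE`), the minimal set `EZ = {11n ≤ x+p, x+3p ≤ 24n, x+4p ≤ 30n, 2x+5p ≠ 41n}` with its net exponents for
`b(n)` and — away from the ONE pair of classes through the moved points `11n`, `30n` — for `b(n)+e₇` (conjugation `x ↦ 41n − (x+5p)`), and
`E_x ≥ −9` for EVERY other class (`classExpE_ge_of_notMin`).  Exact arithmetic; cross-checked at the 8 primes of the cell with `n ≤ 16`
(`code/p1/g6/cellEz_check.py`).  Nothing about irrationality.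
-/

open Finset

namespace Summit.KontsevichZagierPeriods.Zeta5Search.CellE

open Summit.KontsevichZagierPeriods.Zeta5Search.ClusterValuation
open Summit.KontsevichZagierPeriods.Zeta5Search.CasoratianValuation (shift)
open Summit.KontsevichZagierPeriods.Zeta5Search.BigPrime (block shift_zero)
open Summit.KontsevichZagierPeriods.Zeta5Search.CellA
open Summit.KontsevichZagierPeriods.Zeta5Search.CellD (dep7_well netExp_centre sum_six')

/-! ### §1 The residue classes for `24n < 4p < 25n` -/

/-- **The class of `x < p`**: `{x, …, x+6p}` if `x + 6p ≤ 41n`, else `{x, …, x+5p}`. -/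
theorem classSet_bRecE {n p : ℕ} (hp : 24 * n < 4 * p) (hp' : 4 * p < 25 * n) {x : ℕ} (hx : x < p) :
    classSet (bRec n) p x = if x + 6 * p ≤ 41 * n then {x, x + p, x + 2 * p, x + 3 * p, x + 4 * p, x + 5 * p, x + 6 * p}
      else {x, x + p, x + 2 * p, x + 3 * p, x + 4 * p, x + 5 * p} := by
  ext s
  rw [mem_classSet_iff, bRec_zero_toNat]
  have key : (s ≤ 41 * n ∧ (p : ℤ) ∣ (s : ℤ) - x) ↔
      (s = x ∨ s = x + p ∨ s = x + 2 * p ∨ s = x + 3 * p ∨ s = x + 4 * p ∨ s = x + 5 * p ∨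
        (s = x + 6 * p ∧ x + 6 * p ≤ 41 * n)) := by
    constructor
    · rintro ⟨hs, k, hk⟩
      have hk0 : 0 ≤ k := by
        by_contra hneg
        push Not at hneg
        have : (p : ℤ) * k ≤ (p : ℤ) * (-1) := mul_le_mul_of_nonneg_left (by omega) (by omega)
        omega
      have hk7 : k < 7 := by
        by_contra hge
        push Not at hge
        have : (p : ℤ) * 7 ≤ (p : ℤ) * k := mul_le_mul_of_nonneg_left hge (by omega)
        omega
      interval_cases k <;> omega
    · rintro (rfl | rfl | rfl | rfl | rfl | rfl | ⟨rfl, h⟩)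
      · exact ⟨by omega, 0, by ring⟩
      · exact ⟨by omega, 1, by push_cast; ring⟩
      · exact ⟨by omega, 2, by push_cast; ring⟩
      · exact ⟨by omega, 3, by push_cast; ring⟩
      · exact ⟨by omega, 4, by push_cast; ring⟩
      · exact ⟨by omega, 5, by push_cast; ring⟩
      · exact ⟨h, 6, by push_cast; ring⟩
  rw [key]
  split_ifs with h7
  · simp only [mem_insert, mem_singleton]; tauto
  · simp only [mem_insert, mem_singleton]
    constructor
    · rintro (h | h | h | h | h | h | ⟨h, h'⟩)
      · exact Or.inl h
      · exact Or.inr (Or.inl h)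
      · exact Or.inr (Or.inr (Or.inl h))
      · exact Or.inr (Or.inr (Or.inr (Or.inl h)))
      · exact Or.inr (Or.inr (Or.inr (Or.inr (Or.inl h))))
      · exact Or.inr (Or.inr (Or.inr (Or.inr (Or.inr h))))
      · exact absurd h' h7
    · rintro (h | h | h | h | h | h)
      · exact Or.inl h
      · exact Or.inr (Or.inl h)
      · exact Or.inr (Or.inr (Or.inl h))
      · exact Or.inr (Or.inr (Or.inr (Or.inl h)))
      · exact Or.inr (Or.inr (Or.inr (Or.inr (Or.inl h))))
      · exact Or.inr (Or.inr (Or.inr (Or.inr (Or.inr (Or.inl h)))))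

/-- The sum of a function over a seven-point class. -/
theorem sum_seven' {p x : ℕ} (hp0 : 0 < p) (f : ℕ → ℤ) :
    ∑ s ∈ ({x, x + p, x + 2 * p, x + 3 * p, x + 4 * p, x + 5 * p, x + 6 * p} : Finset ℕ), f s =
      f x + f (x + p) + f (x + 2 * p) + f (x + 3 * p) + f (x + 4 * p) + f (x + 5 * p) + f (x + 6 * p) := by
  rw [sum_insert (by simp; omega), sum_insert (by simp; omega), sum_insert (by simp; omega), sum_insert (by simp; omega),
    sum_insert (by simp; omega), sum_pair (by omega)]
  ring

/-- Six-point classes: the exponent sum bounds the class exponent from below. -/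
theorem classExpE_ge_six {n p : ℕ} (hp : 24 * n < 4 * p) (hp' : 4 * p < 25 * n) {x : ℕ} (hx : x < p)
    (h7 : ¬ x + 6 * p ≤ 41 * n) :
    netExp (bRec n) x + netExp (bRec n) (x + p) + netExp (bRec n) (x + 2 * p) + netExp (bRec n) (x + 3 * p) +
      netExp (bRec n) (x + 4 * p) + netExp (bRec n) (x + 5 * p) ≤ classExp (bRec n) p x := by
  refine le_trans (le_of_eq ?_) (classExp_ge_sum _ _ _)
  rw [classSet_bRecE hp hp' hx, if_neg h7, sum_six' (by omega)]

/-- Seven-point classes: the exponent sum bounds the class exponent from below. -/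
theorem classExpE_ge_seven {n p : ℕ} (hp : 24 * n < 4 * p) (hp' : 4 * p < 25 * n) {x : ℕ} (hx : x < p)
    (h7 : x + 6 * p ≤ 41 * n) :
    netExp (bRec n) x + netExp (bRec n) (x + p) + netExp (bRec n) (x + 2 * p) + netExp (bRec n) (x + 3 * p) +
      netExp (bRec n) (x + 4 * p) + netExp (bRec n) (x + 5 * p) + netExp (bRec n) (x + 6 * p) ≤ classExp (bRec n) p x := by
  refine le_trans (le_of_eq ?_) (classExp_ge_sum _ _ _)
  rw [classSet_bRecE hp hp' hx, if_pos h7, sum_seven' (by omega)]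

/-- Six-point SELF-CONJUGATE classes (`2x + 5p = 41n`, odd `p`): exponent sum plus the centre term `1`. -/
theorem classExpE_six_centre {n p : ℕ} (hp : 24 * n < 4 * p) (hp' : 4 * p < 25 * n) {x : ℕ} (hx : x < p) (hodd : ¬ 2 ∣ p)
    (hc : 2 * x + 5 * p = 41 * n) :
    classExp (bRec n) p x = netExp (bRec n) x + netExp (bRec n) (x + p) + netExp (bRec n) (x + 2 * p) +
      netExp (bRec n) (x + 3 * p) + netExp (bRec n) (x + 4 * p) + netExp (bRec n) (x + 5 * p) + 1 := by
  have hcen : ¬ (2 : ℤ) ∣ bRec n 0 ∧ CentreIn (bRec n) p x := by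
    rw [CentreIn, bRec_zero]
    refine ⟨fun h2 => hodd ?_, ⟨-5, by omega⟩⟩
    have h2' : (2 : ℤ) ∣ (p : ℤ) := by
      have e : (41 * (n : ℤ)) = 2 * ((x : ℤ) + 2 * p) + p := by omega
      rw [e] at h2
      exact (dvd_add_right (dvd_mul_right 2 _)).1 h2
    exact Int.natCast_dvd_natCast.1 h2'
  unfold classExp
  rw [if_pos hcen, classSet_bRecE hp hp' hx, if_neg (by omega), sum_six' (by omega)]

/-- **Centre-freeness** on cell E: `2x + 5p ≠ 41n` and `2x + 6p ≠ 41n` exclude the centre residue. -/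
theorem not_centreInE {n p : ℕ} (hp : 24 * n < 4 * p) (hp' : 4 * p < 25 * n) {x : ℕ} (hx : x < p)
    (h5 : 2 * x + 5 * p ≠ 41 * n) (h6 : 2 * x + 6 * p ≠ 41 * n) : ¬ CentreIn (bRec n) p x := by
  rintro ⟨k, hk⟩
  rw [bRec_zero] at hk
  have hk1 : -7 < k := by
    by_contra hle
    push Not at hle
    have : (p : ℤ) * k ≤ (p : ℤ) * (-7) := mul_le_mul_of_nonneg_left hle (by omega)
    omega
  have hk2 : k < -4 := by
    by_contra hge
    push Not at hge
    have : (p : ℤ) * (-4) ≤ (p : ℤ) * k := mul_le_mul_of_nonneg_left hge (by omega)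
    omega
  interval_cases k <;> omega

/-! ### §2 The minimal classes: the centre-free six-point palindromes `(1,0,−6,−6,0,1)` -/

/-- `EZ = {11n ≤ x+p, x+3p ≤ 24n, x+4p ≤ 30n, 2x+5p ≠ 41n}`. -/
def EZ (n p : ℕ) : Finset ℕ :=
  (range p).filter fun x => 11 * n ≤ x + p ∧ x + 3 * p ≤ 24 * n ∧ x + 4 * p ≤ 30 * n ∧ 2 * x + 5 * p ≠ 41 * n

/-- Membership in `EZ`. -/
theorem mem_ez {n p x : ℕ} :
    x ∈ EZ n p ↔ x < p ∧ 11 * n ≤ x + p ∧ x + 3 * p ≤ 24 * n ∧ x + 4 * p ≤ 30 * n ∧ 2 * x + 5 * p ≠ 41 * n := by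
  simp [EZ]

/-- `EZ ⊆ range p`. -/
theorem ez_subset (n p : ℕ) : EZ n p ⊆ range p := fun _ hx => mem_range.2 (mem_ez.1 hx).1

/-- Net exponents of a class of `EZ` for `b(n)`: `(1,0,−6,−6,0,1)`; six points; shape data. -/
theorem netExp_ez {n p : ℕ} (hp : 24 * n < 4 * p) (hp' : 4 * p < 25 * n) {x : ℕ} (hx : x ∈ EZ n p) :
    (netExp (bRec n) x = 1 ∧ netExp (bRec n) (x + p) = 0 ∧ netExp (bRec n) (x + 2 * p) = -6 ∧
      netExp (bRec n) (x + 3 * p) = -6 ∧ netExp (bRec n) (x + 4 * p) = 0 ∧ netExp (bRec n) (x + 5 * p) = 1) ∧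
    x < p ∧ x + 5 * p ≤ 41 * n ∧ 41 * n < x + 5 * p + p ∧ 2 * x + 5 * p ≠ 41 * n ∧ 2 * x + 6 * p ≠ 41 * n := by
  rw [mem_ez] at hx
  obtain ⟨hxp, h11, h24, h30, hself⟩ := hx
  have e0 : netExp (bRec n) x = 1 := by
    rw [netExp_bRec_of_ne n x (by omega), dep7_low (by omega)]; norm_num
  have e1 : netExp (bRec n) (x + p) = 0 := by
    rw [netExp_bRec_of_ne n (x + p) (by omega), dep7_lower (by norm_num : 1 ≤ 7) (by omega) (by omega)]; norm_num
  have e2 : netExp (bRec n) (x + 2 * p) = -6 := by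
    rw [netExp_bRec_of_ne n (x + 2 * p) (by omega), dep7_well (by omega) (by omega)]; norm_num
  have e3 : netExp (bRec n) (x + 3 * p) = -6 := by
    rw [netExp_bRec_of_ne n (x + 3 * p) (by omega), dep7_well (by omega) (by omega)]; norm_num
  have e4 : netExp (bRec n) (x + 4 * p) = 0 := by
    rw [netExp_bRec_of_ne n (x + 4 * p) (by omega), dep7_upper (by norm_num : 1 ≤ 7) (by omega) (by omega)]; norm_num
  have e5 : netExp (bRec n) (x + 5 * p) = 1 := by
    rw [netExp_bRec_of_ne n (x + 5 * p) (by omega), dep7_high (by omega)]; norm_num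
  exact ⟨⟨e0, e1, e2, e3, e4, e5⟩, hxp, by omega, by omega, hself, by omega⟩

/-- Net exponents of a class of `EZ` NOT through the moved points `11n`, `30n`, for `b(n) + e₇`: the same type. -/
theorem netExp_ez_shift {n p : ℕ} (hp : 24 * n < 4 * p) (hp' : 4 * p < 25 * n) {x : ℕ} (hx : x ∈ EZ n p)
    (hh1 : x + p ≠ 11 * n) (hh4 : x + 4 * p ≠ 30 * n) :
    netExp (shift (bRec n) 7) x = 1 ∧ netExp (shift (bRec n) 7) (x + p) = 0 ∧ netExp (shift (bRec n) 7) (x + 2 * p) = -6 ∧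
      netExp (shift (bRec n) 7) (x + 3 * p) = -6 ∧ netExp (shift (bRec n) 7) (x + 4 * p) = 0 ∧
      netExp (shift (bRec n) 7) (x + 5 * p) = 1 := by
  obtain ⟨⟨e0, e1, e2, e3, e4, e5⟩, hxp, h5, h6, -, -⟩ := netExp_ez hp hp' hx
  rw [mem_ez] at hx
  refine ⟨?_, ?_, ?_, ?_, ?_, ?_⟩
  · rw [netExp_shift7 n x (by omega) (by omega), e0]
  · rw [netExp_shift7 n (x + p) hh1 (by omega), e1]
  · rw [netExp_shift7 n (x + 2 * p) (by omega) (by omega), e2]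
  · rw [netExp_shift7 n (x + 3 * p) (by omega) (by omega), e3]
  · rw [netExp_shift7 n (x + 4 * p) (by omega) hh4, e4]
  · rw [netExp_shift7 n (x + 5 * p) (by omega) (by omega), e5]

/-- The conjugation `x ↦ 41n − (x + 5p)` maps `EZ` onto itself and swaps the two hit conditions. -/
theorem conj_mem_ez {n p x : ℕ} (hp : 24 * n < 4 * p) (hx : x ∈ EZ n p) :
    41 * n - (x + 5 * p) ∈ EZ n p ∧ (x + p = 11 * n ↔ 41 * n - (x + 5 * p) + 4 * p = 30 * n) ∧
      (x + 4 * p = 30 * n ↔ 41 * n - (x + 5 * p) + p = 11 * n) := by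
  rw [mem_ez] at hx ⊢; omega

/-! ### §3 Every other class has `E_x ≥ −9` -/

/-- Region `x + p < 11n`: `E_x ≥ −9`. -/
theorem classExpE_low {n p x : ℕ} (hp : 24 * n < 4 * p) (hp' : 4 * p < 25 * n) (hx : x < p) (h11 : x + p < 11 * n) :
    -9 ≤ classExp (bRec n) p x := by
  have e0 : netExp (bRec n) x = 1 := by
    rw [netExp_bRec_of_ne n x (by omega), dep7_low (by omega)]; norm_num
  have e1 : netExp (bRec n) (x + p) = 1 := by
    rw [netExp_bRec_of_ne n (x + p) (by omega), dep7_low (by omega)]; norm_num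
  have a1 : x + 2 * p < 13 * n → netExp (bRec n) (x + 2 * p) = -1 := fun h => by
    rw [netExp_bRec_of_ne n (x + 2 * p) (by omega), dep7_lower (by norm_num : 2 ≤ 7) (by omega) (by omega)]; norm_num
  have a2 : 13 * n ≤ x + 2 * p → x + 2 * p < 14 * n → netExp (bRec n) (x + 2 * p) = -2 := fun h h' => by
    rw [netExp_bRec_of_ne n (x + 2 * p) (by omega), dep7_lower (by norm_num : 3 ≤ 7) (by omega) (by omega)]; norm_num
  have a3 : 14 * n ≤ x + 2 * p → x + 2 * p < 15 * n → netExp (bRec n) (x + 2 * p) = -3 := fun h h' => by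
    rw [netExp_bRec_of_ne n (x + 2 * p) (by omega), dep7_lower (by norm_num : 4 ≤ 7) (by omega) (by omega)]; norm_num
  have a4 : 15 * n ≤ x + 2 * p → x + 2 * p < 16 * n → netExp (bRec n) (x + 2 * p) = -4 := fun h h' => by
    rw [netExp_bRec_of_ne n (x + 2 * p) (by omega), dep7_lower (by norm_num : 5 ≤ 7) (by omega) (by omega)]; norm_num
  have a5 : 16 * n ≤ x + 2 * p → x + 2 * p < 17 * n → netExp (bRec n) (x + 2 * p) = -5 := fun h h' => by
    rw [netExp_bRec_of_ne n (x + 2 * p) (by omega), dep7_lower (by norm_num : 6 ≤ 7) (by omega) (by omega)]; norm_num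
  have a6 : 17 * n ≤ x + 2 * p → netExp (bRec n) (x + 2 * p) = -6 := fun h => by
    rw [netExp_bRec_of_ne n (x + 2 * p) (by omega), dep7_well (by omega) (by omega)]; norm_num
  have b1 : 2 * (x + 3 * p) ≠ 41 * n → netExp (bRec n) (x + 3 * p) = -6 := fun h => by
    rw [netExp_bRec_of_ne n (x + 3 * p) (by omega), dep7_well (by omega) (by omega)]; norm_num
  have b2 : 2 * (x + 3 * p) = 41 * n → netExp (bRec n) (x + 3 * p) = -5 := fun h => netExp_centre h
  have c1 : x + 4 * p ≤ 25 * n → netExp (bRec n) (x + 4 * p) = -5 := fun h => by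
    rw [netExp_bRec_of_ne n (x + 4 * p) (by omega), dep7_upper (by norm_num : 6 ≤ 7) (by omega) (by omega)]; norm_num
  have c2 : 25 * n < x + 4 * p → x + 4 * p ≤ 26 * n → netExp (bRec n) (x + 4 * p) = -4 := fun h h' => by
    rw [netExp_bRec_of_ne n (x + 4 * p) (by omega), dep7_upper (by norm_num : 5 ≤ 7) (by omega) (by omega)]; norm_num
  have c3 : 26 * n < x + 4 * p → x + 4 * p ≤ 27 * n → netExp (bRec n) (x + 4 * p) = -3 := fun h h' => by
    rw [netExp_bRec_of_ne n (x + 4 * p) (by omega), dep7_upper (by norm_num : 4 ≤ 7) (by omega) (by omega)]; norm_num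
  have c4 : 27 * n < x + 4 * p → x + 4 * p ≤ 28 * n → netExp (bRec n) (x + 4 * p) = -2 := fun h h' => by
    rw [netExp_bRec_of_ne n (x + 4 * p) (by omega), dep7_upper (by norm_num : 3 ≤ 7) (by omega) (by omega)]; norm_num
  have c5 : 28 * n < x + 4 * p → x + 4 * p ≤ 29 * n → netExp (bRec n) (x + 4 * p) = -1 := fun h h' => by
    rw [netExp_bRec_of_ne n (x + 4 * p) (by omega), dep7_upper (by norm_num : 2 ≤ 7) (by omega) (by omega)]; norm_num
  have c6 : 29 * n < x + 4 * p → netExp (bRec n) (x + 4 * p) = 0 := fun h => by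
    rw [netExp_bRec_of_ne n (x + 4 * p) (by omega), dep7_upper (by norm_num : 1 ≤ 7) (by omega) (by omega)]; norm_num
  have e5 : netExp (bRec n) (x + 5 * p) = 1 := by
    rw [netExp_bRec_of_ne n (x + 5 * p) (by omega), dep7_high (by omega)]; norm_num
  by_cases h7 : x + 6 * p ≤ 41 * n
  · have e6 : netExp (bRec n) (x + 6 * p) = 1 := by
      rw [netExp_bRec_of_ne n (x + 6 * p) (by omega), dep7_high (by omega)]; norm_num
    have hE := classExpE_ge_seven hp hp' hx h7
    omega
  · have hE := classExpE_ge_six hp hp' hx h7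
    omega

/-- Region `11n ≤ x + p < 12n` outside `EZ`: six points `(1, 0, −6, −6|−5, 0|1, 1)`; `E = −10` only on `EZ`, the self-conjugate classes get `+1`. -/
theorem classExpE_R11 {n p x : ℕ} (hp : 24 * n < 4 * p) (hp' : 4 * p < 25 * n) (hx : x < p) (hodd : ¬ 2 ∣ p)
    (h11 : 11 * n ≤ x + p) (h12 : x + p < 12 * n) (hZ : 24 * n < x + 3 * p ∨ 30 * n < x + 4 * p ∨ 2 * x + 5 * p = 41 * n) :
    -9 ≤ classExp (bRec n) p x := by
  have e0 : netExp (bRec n) x = 1 := by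
    rw [netExp_bRec_of_ne n x (by omega), dep7_low (by omega)]; norm_num
  have e1 : netExp (bRec n) (x + p) = 0 := by
    rw [netExp_bRec_of_ne n (x + p) (by omega), dep7_lower (by norm_num : 1 ≤ 7) (by omega) (by omega)]; norm_num
  have e2 : netExp (bRec n) (x + 2 * p) = -6 := by
    rw [netExp_bRec_of_ne n (x + 2 * p) (by omega), dep7_well (by omega) (by omega)]; norm_num
  have b1 : x + 3 * p ≤ 24 * n → netExp (bRec n) (x + 3 * p) = -6 := fun h => by
    rw [netExp_bRec_of_ne n (x + 3 * p) (by omega), dep7_well (by omega) (by omega)]; norm_num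
  have b2 : 24 * n < x + 3 * p → netExp (bRec n) (x + 3 * p) = -5 := fun h => by
    rw [netExp_bRec_of_ne n (x + 3 * p) (by omega), dep7_upper (by norm_num : 6 ≤ 7) (by omega) (by omega)]; norm_num
  have c1 : x + 4 * p ≤ 30 * n → netExp (bRec n) (x + 4 * p) = 0 := fun h => by
    rw [netExp_bRec_of_ne n (x + 4 * p) (by omega), dep7_upper (by norm_num : 1 ≤ 7) (by omega) (by omega)]; norm_num
  have c2 : 30 * n < x + 4 * p → netExp (bRec n) (x + 4 * p) = 1 := fun h => by
    rw [netExp_bRec_of_ne n (x + 4 * p) (by omega), dep7_high (by omega)]; norm_num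
  have e5 : netExp (bRec n) (x + 5 * p) = 1 := by
    rw [netExp_bRec_of_ne n (x + 5 * p) (by omega), dep7_high (by omega)]; norm_num
  have hE := classExpE_ge_six hp hp' hx (by omega)
  have hEc : 2 * x + 5 * p = 41 * n → classExp (bRec n) p x = netExp (bRec n) x + netExp (bRec n) (x + p) +
      netExp (bRec n) (x + 2 * p) + netExp (bRec n) (x + 3 * p) + netExp (bRec n) (x + 4 * p) + netExp (bRec n) (x + 5 * p) + 1 :=
    fun h => classExpE_six_centre hp hp' hx hodd h
  omega

/-- Region `12n ≤ x + p`: six points `(1, −1, −6, −5, 1, 1)`, `E = −9`. -/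
theorem classExpE_R12 {n p x : ℕ} (hp : 24 * n < 4 * p) (hp' : 4 * p < 25 * n) (hx : x < p) (h12 : 12 * n ≤ x + p) :
    -9 ≤ classExp (bRec n) p x := by
  have e0 : netExp (bRec n) x = 1 := by
    rw [netExp_bRec_of_ne n x (by omega), dep7_low (by omega)]; norm_num
  have e1 : netExp (bRec n) (x + p) = -1 := by
    rw [netExp_bRec_of_ne n (x + p) (by omega), dep7_lower (by norm_num : 2 ≤ 7) (by omega) (by omega)]; norm_num
  have e2 : netExp (bRec n) (x + 2 * p) = -6 := by
    rw [netExp_bRec_of_ne n (x + 2 * p) (by omega), dep7_well (by omega) (by omega)]; norm_num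
  have e3 : netExp (bRec n) (x + 3 * p) = -5 := by
    rw [netExp_bRec_of_ne n (x + 3 * p) (by omega), dep7_upper (by norm_num : 6 ≤ 7) (by omega) (by omega)]; norm_num
  have e4 : netExp (bRec n) (x + 4 * p) = 1 := by
    rw [netExp_bRec_of_ne n (x + 4 * p) (by omega), dep7_high (by omega)]; norm_num
  have e5 : netExp (bRec n) (x + 5 * p) = 1 := by
    rw [netExp_bRec_of_ne n (x + 5 * p) (by omega), dep7_high (by omega)]; norm_num
  have hE := classExpE_ge_six hp hp' hx (by omega)
  omega

/-- **THE NON-MINIMAL CLASSES**: for `x < p` outside `EZ`, `E_x(b(n), p) ≥ −9`. -/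
theorem classExpE_ge_of_notMin {n p x : ℕ} (hp : 24 * n < 4 * p) (hp' : 4 * p < 25 * n) (hx : x < p) (hodd : ¬ 2 ∣ p)
    (h1 : x ∉ EZ n p) : -9 ≤ classExp (bRec n) p x := by
  rw [mem_ez] at h1
  by_cases h11 : x + p < 11 * n
  · exact classExpE_low hp hp' hx h11
  push Not at h11
  by_cases h12 : x + p < 12 * n
  · refine classExpE_R11 hp hp' hx hodd h11 h12 ?_
    by_contra hc; push Not at hc; exact h1 ⟨hx, h11, hc.1, hc.2.1, hc.2.2⟩
  push Not at h12
  exact classExpE_R12 hp hp' hx h12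

end Summit.KontsevichZagierPeriods.Zeta5Search.CellE
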